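import Literature.NumberTheory.Li1992.RallisInnerProductThetaLift
import Literature.NumberTheory.Automorphic.AdelicPiSchwartzBruhatPlancherel
import Mathlib.MeasureTheory.Function.L2Space
import HarnessLib

/-!
# Continuity of the Weil-representation matrix coefficient `h ↦ ⟨ω(h)Φ₁, Φ₂⟩` ([Li1992, (25)–(26)]) from strong
# `L²`-continuity

Topic `NumberTheory/Li1992`; namespace `Literature.NumberTheory.Li1992` (continues `RallisInnerProductThetaLift`).  KERNEL
ONLY: proved theorems, no definition, no named fact, no `sorry`; nothing of [Li1992], [Weil1964] or
[GelbartRogawski1991] is asserted.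

[Li1992, Thm 2.1 (26) p. 184] integrates the matrix coefficient `h ↦ ⟨ω(h)φ₁, φ₂⟩` of the Weil representation
([Li1992, (25)]) against a matrix coefficient of `π` over `G'(A)`; the rank-one letter of the cell's E-2 line
(`Li1992.RallisInnerProductFormulaUnitaryDualPairRankOneCont`, junction J-E2-3, ruling (A″)) carries the CONTINUITY of
this coefficient on `U(J_W)(𝔸_F)` as an explicit binder `hcoef`, to be discharged by each consumer.  Print takes it for
granted: p. 178 realises `ω` on the Hilbert space `L²(X)` as a unitary REPRESENTATION (strongly continuous), its smooth
vectors being `S(X(A))`; [GelbartRogawski1991, §3.1 p. 454 L21–27, Prop. 3.1.1 p. 455 L1–2] phrase the same as "`M_g` is an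
operator on the space of `ρ_ψ`" along a "continuous section".  In the tree the pairing of [Li1992, p. 178 ∕ (13)] is
`Li1992.schwartzPairing F ι ν_X Φ₁ Φ₂ = ∫ Φ₁ \overline{Φ₂} dν_X` on `𝒮(𝔸_Fⁿ) = piSchwartzBruhat F ι`, and a Hilbert-space
model is any CLASS MAP `i : 𝒮(𝔸_Fⁿ) →ₗ[ℂ] L²(𝔸_Fⁿ, ν_X)` with `i Φ =ᵐ Φ` (the shape in which the tree's strong-continuity
theorems `Weil1964.continuous_toL2_omega_comp`, `Weil1964.continuous_toL2_omega_cmPairSplitting_of_signs_one` are stated;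
`Automorphic.piSchwartzBruhatToLp` is one such `i`).  This file is the functional-analytic step from strong continuity of
the classes to continuity of the coefficients:

* §1 `schwartzPairing_eq_inner` — `⟨Φ₁, Φ₂⟩ = ⟪i Φ₂, i Φ₁⟫_{L²(ν_X)}` for every class map `i` (Mathlib's inner product is
  conjugate-linear in the FIRST slot, print's pairing in the second); `continuous_schwartzPairing_of_continuous_toLp`
  (`_right`): along ANY family `h ↦ Φ_h` whose classes `i Φ_h` move continuously in `L²`, `h ↦ ⟨Φ_h, Ψ⟩` and
  `h ↦ ⟨Ψ, Φ_h⟩` are continuous.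
* §2 the unitary dual pair `(U(J_V), U(J_W))` of [GelbartRogawski1991, §3.1–3.2] (`UnitaryDualPair.pairRep s`, ANY
  homomorphism `s` into `Mp_ψ(𝕎_𝔸)ᶜᵒⁿᵗ`, any ranks `N, M`):
  **`UnitaryDualPair.continuous_schwartzPairing_pairRep_of_continuous_toLp`** — strong `L²`-continuity of
  `h ↦ i (ω(s_pair(1, h))Φ)` for every `Φ` (hypothesis `hL2`) implies continuity of `h ↦ ⟨ω(s_pair(1,h))Φ₁, Φ₂⟩` for all
  `Φ₁ Φ₂` — the binder `hcoef` of `…RankOneCont` token for token (at `M := 1`); the two-variable forms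
  `…_pairRep_of_continuous_toLp₂`, `…_pairRep_one_of_continuous_toLp₂` take the hypothesis on `U(J_V)(𝔸) × U(J_W)(𝔸)`,
  which is the CONCLUSION SHAPE of ★ `Weil1964.continuous_toL2_omega_cmPairSplitting_of_signs_one` (the CM pair
  splitting of record, hermitian line `W`): so at the P4 consumer datum (`s := splittingOf hGR₀`, `cmPairSplitting hGR₀ =
  pairSplitting (splittingOf hGR₀)` by definition) `hcoef` is `…_pairRep_one_of_continuous_toLp₂ … (that ★ theorem …)`.

NOT here: Weil's Lemme 5 ∕ n° 39 for an ARBITRARY compatible section over arbitrary `(F, E, T_V, T_W)` (the tree proves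
strong continuity only along the sections it constructs); in that generality strong `L²`-continuity stays a hypothesis —
exactly as `hρ` (theta majorants) and `hiso` (unitarity) are hypotheses of ★ `Li1992.RallisInnerProductFormulaUnitaryDualPair`.
The instantiated CM corollary (importing `Weil1964/ArchDualPairL2Continuity`) is filed separately.

## References
* [Li1992] J.-S. Li, J. reine angew. Math. 428 (1992) 177–217, p. 178, (13) p. 182, (25)–(26) p. 184.
* [Weil1964] A. Weil, Acta Math. 111 (1964) 143–211, Chap. III n° 39 p. 189, n° 41 Lemme 5 p. 192.
* [GelbartRogawski1991] S. Gelbart, J. Rogawski, Invent. Math. 105 (1991) 445–472, §3.1 p. 454 L21–27, Prop. 3.1.1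
  p. 455 L1–2.
-/

set_option autoImplicit false

noncomputable section

open _root_.MeasureTheory NumberField
open scoped ComplexConjugate InnerProductSpace

namespace Literature.NumberTheory.Li1992

open Literature.NumberTheory.Automorphic Literature.NumberTheory.Weil1964
open Literature.NumberTheory.GelbartRogawski1991

/-! ## §1 The pairing as an `L²` inner product; continuity along `L²`-continuous families -/

section Pairing

variable (F : Type) [Field F] [NumberField F] (ι : Type) [Fintype ι]
  [MeasurableSpace (AdeleRing (𝓞 F) F)]
  (νX : Measure (ι → AdeleRing (𝓞 F) F))
  (i : piSchwartzBruhat F ι →ₗ[ℂ] Lp ℂ 2 νX)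
  (hi : ∀ Φ : piSchwartzBruhat F ι, ((i Φ : Lp ℂ 2 νX) : (ι → AdeleRing (𝓞 F) F) → ℂ) =ᵐ[νX]
    (Φ : (ι → AdeleRing (𝓞 F) F) → ℂ))

include hi in
/-- **`⟨Φ₁, Φ₂⟩ = ⟪i Φ₂, i Φ₁⟫_{L²(ν_X)}`**: print's pairing `∫ Φ₁ \overline{Φ₂} dν_X` on `S(X(A))` ([Li1992, p. 178; (13) p. 182])
is the inner product of the classes in the Hilbert space `L²(X(A))`, for every class map `i` with `i Φ = Φ` a.e. (Mathlib's
`⟪·,·⟫` is conjugate-linear in the first variable, print's in the second — hence the swap). [cite: Li1992, p. 178 and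
(13) p. 182] -/
theorem schwartzPairing_eq_inner (Φ₁ Φ₂ : piSchwartzBruhat F ι) :
    schwartzPairing F ι νX Φ₁ Φ₂ = ⟪i Φ₂, i Φ₁⟫_ℂ := by
  rw [schwartzPairing_apply, MeasureTheory.L2.inner_def]
  refine integral_congr_ae ?_
  filter_upwards [hi Φ₁, hi Φ₂] with x h₁ h₂
  rw [RCLike.inner_apply, h₁, h₂]

include hi in
/-- **continuity of `h ↦ ⟨Φ_h, Ψ⟩` along an `L²`-continuous family**: if the classes `i Φ_h ∈ L²(X(A))` depend continuously
on `h`, so does the pairing with a fixed `Ψ ∈ S(X(A))` (continuity of the inner product of the unitary `L²`-model,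
[Li1992, p. 178]). [cite: Li1992, p. 178 and (13) p. 182] -/
theorem continuous_schwartzPairing_of_continuous_toLp {H : Type*} [TopologicalSpace H]
    (Φh : H → piSchwartzBruhat F ι) (hc : Continuous fun h => i (Φh h)) (Ψ : piSchwartzBruhat F ι) :
    Continuous fun h => schwartzPairing F ι νX (Φh h) Ψ := by
  have hrw : (fun h => schwartzPairing F ι νX (Φh h) Ψ) = fun h => ⟪i Ψ, i (Φh h)⟫_ℂ := by
    funext h
    exact schwartzPairing_eq_inner F ι νX i hi (Φh h) Ψ
  rw [hrw]
  exact continuous_const.inner hc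

include hi in
/-- the same in the conjugate-linear slot: `h ↦ ⟨Ψ, Φ_h⟩` is continuous. [cite: Li1992, p. 178 and (13) p. 182] -/
theorem continuous_schwartzPairing_of_continuous_toLp_right {H : Type*} [TopologicalSpace H]
    (Φh : H → piSchwartzBruhat F ι) (hc : Continuous fun h => i (Φh h)) (Ψ : piSchwartzBruhat F ι) :
    Continuous fun h => schwartzPairing F ι νX Ψ (Φh h) := by
  have hrw : (fun h => schwartzPairing F ι νX Ψ (Φh h)) = fun h => ⟪i (Φh h), i Ψ⟫_ℂ := by
    funext h
    exact schwartzPairing_eq_inner F ι νX i hi Ψ (Φh h)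
  rw [hrw]
  exact hc.inner continuous_const

end Pairing

/-! ## §2 The unitary dual pair: the coefficient-continuity binder from strong `L²`-continuity -/

section DualPair

variable (F E : Type) [Field F] [NumberField F] [Field E] [NumberField E] [Algebra F E]
  (c : E ≃ₐ[F] E) (N M : ℕ) {n : ℕ} (e : Fin N × Fin M ≃ Fin n)
  (JV : Matrix (Fin N) (Fin N) E) (JW : Matrix (Fin M) (Fin M) E)
  {TV : Matrix (Fin N) (Fin N) F} {TW : Matrix (Fin M) (Fin M) F}
  (s : UnitaryGroup.adelicPair F E c N M JV JW →* adelicMpCont F (Fin n) (UnitaryDualPair.adelicGram F e TV TW))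
  [MeasurableSpace (AdeleRing (𝓞 F) F)]
  (νX : Measure (Fin n → AdeleRing (𝓞 F) F))
  (i : piSchwartzBruhat F (Fin n) →ₗ[ℂ] Lp ℂ 2 νX)
  (hi : ∀ Φ : piSchwartzBruhat F (Fin n), ((i Φ : Lp ℂ 2 νX) : (Fin n → AdeleRing (𝓞 F) F) → ℂ) =ᵐ[νX]
    (Φ : (Fin n → AdeleRing (𝓞 F) F) → ℂ))

include hi in
/-- **the binder `hcoef` from strong continuity — the matrix coefficient `h ↦ ⟨ω(1,h)Φ₁, Φ₂⟩_{ν_X}` of [Li1992, (25)] is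
continuous on `U(J_W)(𝔸_F)`** for every `Φ₁ Φ₂ ∈ S(X(A))`, as soon as `ω = ω_ψ ∘ s_pair` is strongly continuous on
`L²(X(A))` along `h ↦ (1, h)` (`hL2`: every orbit of classes `h ↦ i (ω(s_pair(1,h))Φ)` is continuous — print's standing
assumption p. 178 that `ω` is a unitary representation on `L²(X)`, the twin of the unitarity clause `hiso`).  At `M := 1`
the conclusion is the binder `hcoef` of `Li1992.RallisInnerProductFormulaUnitaryDualPairRankOneCont` token for token.
[cite: Li1992, (25)–(26) p. 184 and p. 178] -/
theorem _root_.Literature.NumberTheory.GelbartRogawski1991.UnitaryDualPair.continuous_schwartzPairing_pairRep_of_continuous_toLp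
    (hL2 : ∀ Φ : piSchwartzBruhat F (Fin n), Continuous fun h : UnitaryGroup.adelic F E c M JW =>
      i (UnitaryDualPair.pairRep F E c N M e JV JW s (1, h) Φ))
    (Φ₁ Φ₂ : piSchwartzBruhat F (Fin n)) :
    Continuous fun h : UnitaryGroup.adelic F E c M JW =>
      schwartzPairing F (Fin n) νX (UnitaryDualPair.pairRep F E c N M e JV JW s (1, h) Φ₁) Φ₂ :=
  continuous_schwartzPairing_of_continuous_toLp F (Fin n) νX i hi
    (fun h : UnitaryGroup.adelic F E c M JW => UnitaryDualPair.pairRep F E c N M e JV JW s (1, h) Φ₁) (hL2 Φ₁) Φ₂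

include hi in
/-- **two-variable form**: if every orbit of classes `(u₁, u₂) ↦ i (ω(s_pair(u₁, u₂))Φ)` is continuous on
`U(J_V)(𝔸_F) × U(J_W)(𝔸_F)`, then so is every matrix coefficient `(u₁, u₂) ↦ ⟨ω(s_pair(u₁,u₂))Φ₁, Φ₂⟩_{ν_X}`.
[cite: Li1992, (25) p. 184 and p. 178] -/
theorem _root_.Literature.NumberTheory.GelbartRogawski1991.UnitaryDualPair.continuous_schwartzPairing_pairRep_of_continuous_toLp₂
    (hL2 : ∀ Φ : piSchwartzBruhat F (Fin n),
      Continuous fun p : UnitaryGroup.adelic F E c N JV × UnitaryGroup.adelic F E c M JW =>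
        i (UnitaryDualPair.pairRep F E c N M e JV JW s p Φ))
    (Φ₁ Φ₂ : piSchwartzBruhat F (Fin n)) :
    Continuous fun p : UnitaryGroup.adelic F E c N JV × UnitaryGroup.adelic F E c M JW =>
      schwartzPairing F (Fin n) νX (UnitaryDualPair.pairRep F E c N M e JV JW s p Φ₁) Φ₂ :=
  continuous_schwartzPairing_of_continuous_toLp F (Fin n) νX i hi
    (fun p => UnitaryDualPair.pairRep F E c N M e JV JW s p Φ₁) (hL2 Φ₁) Φ₂

include hi in
/-- **from the two-variable hypothesis to `hcoef`**: strong continuity on `U(J_V)(𝔸) × U(J_W)(𝔸)` (the conclusion shape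
of ★ `Weil1964.continuous_toL2_omega_cmPairSplitting_of_signs_one` for the CM pair splitting of record, `cmPairSplitting
hGR = pairSplitting (splittingOf hGR)` by definition) gives continuity of `h ↦ ⟨ω(s_pair(1,h))Φ₁, Φ₂⟩_{ν_X}` — the
binder `hcoef` at the consumer datum. [cite: Li1992, (25)–(26) p. 184; GelbartRogawski1991, §3.1 Prop. 3.1.1 p. 455
L1–2] -/
theorem _root_.Literature.NumberTheory.GelbartRogawski1991.UnitaryDualPair.continuous_schwartzPairing_pairRep_one_of_continuous_toLp₂
    (hL2 : ∀ Φ : piSchwartzBruhat F (Fin n),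
      Continuous fun p : UnitaryGroup.adelic F E c N JV × UnitaryGroup.adelic F E c M JW =>
        i (UnitaryDualPair.pairRep F E c N M e JV JW s p Φ))
    (Φ₁ Φ₂ : piSchwartzBruhat F (Fin n)) :
    Continuous fun h : UnitaryGroup.adelic F E c M JW =>
      schwartzPairing F (Fin n) νX (UnitaryDualPair.pairRep F E c N M e JV JW s (1, h) Φ₁) Φ₂ :=
  UnitaryDualPair.continuous_schwartzPairing_pairRep_of_continuous_toLp F E c N M e JV JW s νX i hi
    (fun Φ => (hL2 Φ).comp (Continuous.prodMk continuous_const continuous_id)) Φ₁ Φ₂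

include hi in
/-- the conjugate-linear slot, two variables: `(u₁, u₂) ↦ ⟨Φ₂, ω(s_pair(u₁,u₂))Φ₁⟩_{ν_X}` is continuous under the same
strong-continuity hypothesis. [cite: Li1992, (25) p. 184 and p. 178] -/
theorem _root_.Literature.NumberTheory.GelbartRogawski1991.UnitaryDualPair.continuous_schwartzPairing_pairRep_right_of_continuous_toLp₂
    (hL2 : ∀ Φ : piSchwartzBruhat F (Fin n),
      Continuous fun p : UnitaryGroup.adelic F E c N JV × UnitaryGroup.adelic F E c M JW =>
        i (UnitaryDualPair.pairRep F E c N M e JV JW s p Φ))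
    (Φ₁ Φ₂ : piSchwartzBruhat F (Fin n)) :
    Continuous fun p : UnitaryGroup.adelic F E c N JV × UnitaryGroup.adelic F E c M JW =>
      schwartzPairing F (Fin n) νX Φ₂ (UnitaryDualPair.pairRep F E c N M e JV JW s p Φ₁) :=
  continuous_schwartzPairing_of_continuous_toLp_right F (Fin n) νX i hi
    (fun p => UnitaryDualPair.pairRep F E c N M e JV JW s p Φ₁) (hL2 Φ₁) Φ₂

end DualPair

end Literature.NumberTheory.Li1992

end
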